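import Literature.MathematicalPhysics.QuantumFieldTheory.Balaban1983to89.Beta.AveragingMixedJetTables

/-!
# `BalabanUV.Beta.RootedJetDictionary` — THE ROOTED JET ↔ COUNT DICTIONARY (orders 0, 1, 2) FOR NODE 12b's `PhiGAt ρ`
# (β sub-cell, row D1 letter chain HR-W-LET, MIXED sub-chain M3a toward the level-0 mixed identity (M₀); an3 gen 33)

HONEST FRAMING (cell charter, verbatim): «discharging BetaPertH makes Bałaban's UV stability UNCONDITIONAL — a real
constructive-QFT result; it is NOT the continuum limit and NOT the Clay problem.»  HONEST DEPENDENCY (verbatim): «continuum YM on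
T⁴ ⇐ BetaPertH ∧ nine spine estimates (0/9 proved); BetaPertH ⇐ (D1) ∧ (D4) ∧ CAP+tail; G-an2-4 gates asym, D1 and NE2/3/4.»
DERIVED cell leaf: [folklore] the ROOTED twins of node 12 `AveragingThirdJet` §6–§7 (`PhiG_X1`, `c00_Qjet`, `c11_logT_PhiY`), re-run verbatim
with node 5ρ's rooted lists (`loopCAt ρ`, root `L·y + ρ`) and node 7aρ's rooted functionals (`linAvgAt ρ`, `hessUAt ρ`), using node 12's
LIST-GENERIC letter calculus (`holG_X1`, `holY_c`, `hol_cross`, `logT_of_c00`, `expT_of_c00`) BY NAME (the `c00`-shadows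
`c00_holG`, `c00_PhiGAt` below are the `Tau.aug`-instances of leaf-05-g7's `TruncatedNil4Calculus.aug_holG_eq_one`∕`aug_PhiGAt_eq_one`,
re-derived in three lines to keep this module inside `Literature` imports).  No statement of Bałaban's papers is typed, no `[cite:]`, no `Prop` is minted, no binder
of the β-function wall (`hW`/`hR`/`D1Tel`/`D1Rep`, (D1), `BetaPertH`) is instantiated or discharged.  NOT summit progress.

## What this module proves (any root `ρ`, `(L : 𝕜) ≠ 0`, `(2 : 𝕜) ≠ 0` where stated)

* §1 ROOTED CONTOUR BOOKKEEPING `Σ_{x ∈ B(y)} A(loop^ρ_x) + L^d • A(c^ρ) = linAvgAt ρ A` and the ORDER-0 SHADOW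
  `Φ^ρ(1 + σV) = 1 + σ · L^{-d} linAvgAt ρ V` (`PhiGAt_X1`, `snd_PhiGAt_X1`).
* §2 **THE UN-NORMALISED ONE-PARAMETER COMPUTATION** on node 12's shadow chart `Y_f = (1 + ρ W_f)(1 + σ B_f)`:
  `c11 (logT Φ^ρ(Y)) = (2L^d)⁻¹ • (hessUAt ρ W B + linAvgAt ρ [W,B])` (`c11_logT_PhiGAt_Y`) — node 12's `c11_logT_PhiY` WITHOUT the
  reference division, whose effect (`+ ½ L^{-2d} [linAvgAt W, linAvgAt B]`, exact BCH in `Tau`) is what turns node 7a's `(2L^{2d})⁻¹ vhU` into the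
  Hessian-type functional.
* §3 TOP-SLOT PERTURBATIONS of group-like letters are additive through holonomy, `logT`, `expT` and `Φ^ρ` (`holG_add_top`, `PhiGAt_add_top`), and
  node 12b's SYMMETRIC letter is such a perturbation of the shadow letter, `Zf W V = Y(V;W) + τ₁τ₂ · ½[W,V]`; hence
  **`c11 (logT Φ^ρ(Zf W V, Zb W V)) = (2L^d)⁻¹ • hessUAt ρ W V`** (`c11_logT_PhiGAt_Zf`): the symmetric exponential chart computes EXACTLY node
  7aρ's polarised rooted Hessian functional (the `[·,·]`-letter terms cancel).

## What is NOT here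
Nothing about the mixed chart `PhiMAt`/`MσGAt` (M3b `RootedMixedJetContact`), no table, no packed identity, no kernel (`hessFFAt`, `linKerAt`).
-/

namespace Summit.QuantumFields.BalabanUV.Beta.RootedJetDictionary

open Finset
open Literature.MathematicalPhysics.QuantumFieldTheory.Balaban1983to89
open Literature.MathematicalPhysics.QuantumFieldTheory.Balaban1983to89.Beta
open Literature.MathematicalPhysics.QuantumFieldTheory.Balaban1983to89.Beta.AffineAveraging
open Literature.MathematicalPhysics.QuantumFieldTheory.Balaban1983to89.Beta.AveragingContours
open Literature.MathematicalPhysics.QuantumFieldTheory.Balaban1983to89.Beta.AveragingContoursRooted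
open Literature.MathematicalPhysics.QuantumFieldTheory.Balaban1983to89.Beta.TransportedContourVariables
open Literature.MathematicalPhysics.QuantumFieldTheory.Balaban1983to89.Beta.AveragingHessianKernels
open Literature.MathematicalPhysics.QuantumFieldTheory.Balaban1983to89.Beta.AveragingHessianKernelsRooted
open Literature.MathematicalPhysics.QuantumFieldTheory.Balaban1983to89.Beta.AveragingThirdJet
open Literature.MathematicalPhysics.QuantumFieldTheory.Balaban1983to89.Beta.AveragingThirdJet.Tau
open Literature.MathematicalPhysics.QuantumFieldTheory.Balaban1983to89.Beta.AveragingMixedJetTables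

variable {𝕜 : Type*} [Field 𝕜] {d : ℕ} {𝔸 : Type*} [Ring 𝔸] [Algebra 𝕜 𝔸]

/-! ## §1 Rooted contour bookkeeping and the order-`0` shadow -/

omit [Algebra 𝕜 𝔸] in
/-- [folklore] ROOTED CONTOUR BOOKKEEPING over an arbitrary additive group: `Σ_{x ∈ B(y)} A(loop^ρ_x) + L^d • A(c^ρ) = linAvgAt ρ A`
(node 12's `sum_box_sum_loopC_add` with node 5ρ's rooted lists). -/
theorem sum_box_sum_loopCAt_add {R : Type*} [AddCommGroup R] (ρ : Fin d → ℤ) (A : Form1 d R) (L : ℕ) (μ : Fin d)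
    (y : Fin d → ℤ) :
    ∑ b ∈ box d L, (loopCAt ρ A L μ y b).sum + (L ^ d) • (segUp A ((L : ℤ) • y + ρ) μ L).sum = linAvgAt ρ A L μ y := by
  have hcard : (box d L).card = L ^ d := by simp [AffineAveraging.box, Fintype.card_piFinset]
  have hloop : ∀ b, (loopCAt ρ A L μ y b).sum = (gammaCAt ρ A L μ y b).sum - (segUp A ((L : ℤ) • y + ρ) μ L).sum := by
    intro b; simp only [loopCAt, List.sum_append, rev_sum]; abel
  simp only [hloop, Finset.sum_sub_distrib, Finset.sum_const, hcard, linAvgAt, sub_add_cancel]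

/-- [folklore] … solved for the loop sum, over `𝕜`: `L^{-d} Σ_x A(loop^ρ_x) = L^{-d} linAvgAt ρ A − A(c^ρ)`. -/
theorem inv_smul_sum_box_loopCAt (ρ : Fin d → ℤ) (A : Form1 d 𝔸) {L : ℕ} (hL : (L : 𝕜) ≠ 0) (μ : Fin d) (y : Fin d → ℤ) :
    ((L : 𝕜) ^ d)⁻¹ • ∑ b ∈ box d L, (loopCAt ρ A L μ y b).sum
      = ((L : 𝕜) ^ d)⁻¹ • linAvgAt ρ A L μ y - (segUp A ((L : ℤ) • y + ρ) μ L).sum := by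
  rw [eq_sub_of_add_eq (sum_box_sum_loopCAt_add ρ A L μ y), smul_sub, ← Nat.cast_smul_eq_nsmul 𝕜, Nat.cast_pow, smul_smul,
    inv_mul_cancel₀ (pow_ne_zero d hL), one_smul]

/-- [folklore] (42)ρ ON THE ORDER-`0` SHADOW: `Φ^ρ(1 + σV) = 1 + σ (V(c^ρ) + L^{-d} Σ_x V(loop^ρ_x))`. -/
theorem PhiGAt_X1 (ρ : Fin d → ℤ) (V : Form1 d 𝔸) (L : ℕ) (μ : Fin d) (y : Fin d → ℤ) :
    PhiGAt 𝕜 ρ (X1 V) (X1b V) L μ y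
      = dmk 1 ((segUp V ((L : ℤ) • y + ρ) μ L).sum + ((L : 𝕜) ^ d)⁻¹ • ∑ b ∈ box d L, (loopCAt ρ V L μ y b).sum) := by
  rw [PhiGAt]
  have hlog : ∀ b ∈ box d L,
      logT 𝕜 (holG (X1 V) (X1b V) (loopCAt ρ δ L μ y b)) = dmk 0 ((loopCAt ρ V L μ y b).sum) := by
    intro b _
    rw [holG_X1 V (lettersIn_loopCAt_top ρ δ L μ y b), loopCAt_map, mapForm_letterHom]
    exact logT_dmk_one _
  rw [Finset.sum_congr rfl hlog, holG_X1 V (lettersIn_segUp_top δ _ μ L), segUp_map, mapForm_letterHom,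
    sum_dmk_zero, smul_dmk_zero, expT_dmk_zero]
  exact TrivSqZeroExt.ext (by simp) (by simp)

/-- [folklore] **ORDER-0 IDENTIFICATION (rooted)**: the `σ`-part of `Φ^ρ(1 + σV)` is `L^{-d} • linAvgAt ρ V` (nodes 5ρ/7aρ). -/
theorem snd_PhiGAt_X1 (ρ : Fin d → ℤ) (V : Form1 d 𝔸) {L : ℕ} (hL : (L : 𝕜) ≠ 0) (μ : Fin d) (y : Fin d → ℤ) :
    (PhiGAt 𝕜 ρ (X1 V) (X1b V) L μ y).snd = ((L : 𝕜) ^ d)⁻¹ • linAvgAt ρ V L μ y := by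
  rw [PhiGAt_X1, snd_dmk, inv_smul_sum_box_loopCAt ρ V hL, add_sub_cancel]

/-- [folklore] … and its group part is `1`. -/
theorem fst_PhiGAt_X1 (ρ : Fin d → ℤ) (V : Form1 d 𝔸) (L : ℕ) (μ : Fin d) (y : Fin d → ℤ) :
    (PhiGAt 𝕜 ρ (X1 V) (X1b V) L μ y).fst = 1 := by
  rw [PhiGAt_X1, fst_dmk]

/-! ## §2 The un-normalised one-parameter computation on the shadow chart `Y_f = (1 + ρ W_f)(1 + σ B_f)` -/

/-- [folklore] **THE UN-NORMALISED ONE-PARAMETER COMPUTATION (rooted)**: the `σρ`-component of `logT Φ^ρ(Y(W;B))` is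
`(2L^d)⁻¹ • (hessUAt ρ W B + linAvgAt ρ [W,B])` — node 7aρ's rooted Hessian-type functional plus the local commutator letter sum. -/
theorem c11_logT_PhiGAt_Y (ρ : Fin d → ℤ) (W B : Form1 d 𝔸) {L : ℕ} (hL : (L : 𝕜) ≠ 0) (h2 : (2 : 𝕜) ≠ 0) (μ : Fin d)
    (y : Fin d → ℤ) :
    c11 (logT 𝕜 (PhiGAt 𝕜 ρ (Yf W B) (Yb W B) L μ y))
      = ((2 : 𝕜) * (L : 𝕜) ^ d)⁻¹ • (hessUAt ρ W B L μ y + linAvgAt ρ (bw W B) L μ y) := by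
  have hℓ : ((L : 𝕜) ^ d) ≠ 0 := pow_ne_zero d hL
  -- loop data
  have hb : ∀ b ∈ box d L, logT 𝕜 (holG (Yf W B) (Yb W B) (loopCAt ρ δ L μ y b))
      = mk 0 ((loopCAt ρ B L μ y b).sum) ((loopCAt ρ W L μ y b).sum)
          ((2 : 𝕜)⁻¹ • ((loopCAt ρ (bw W B) L μ y b).sum + cross (loopCAt ρ (pairForm W B) L μ y b))) := by
    intro b _
    have hl := lettersIn_loopCAt_top ρ δ L μ y b
    obtain ⟨h0, h1, h1'⟩ := holY_c W B hl
    have hx := hol_cross W B hl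
    rw [loopCAt_map, mapForm_letterHom] at h1 h1'
    simp only [loopCAt_map, mapForm_letterHom, mapForm_letterHom₂] at hx
    rw [logT_of_c00 _ h0, h1, h1', half_of_two h2 hx]
  -- c-path data (from the root)
  obtain ⟨k0, k1, k1'⟩ := holY_c W B (lettersIn_segUp_top δ ((L : ℤ) • y + ρ) μ L)
  have kx := hol_cross W B (lettersIn_segUp_top δ ((L : ℤ) • y + ρ) μ L)
  rw [segUp_map, mapForm_letterHom] at k1 k1'
  simp only [segUp_map, mapForm_letterHom, mapForm_letterHom₂] at kx
  have kc : holG (Yf W B) (Yb W B) (segUp δ ((L : ℤ) • y + ρ) μ L)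
      = mk 1 ((segUp B ((L : ℤ) • y + ρ) μ L).sum) ((segUp W ((L : ℤ) • y + ρ) μ L).sum)
          ((2 : 𝕜)⁻¹ • (((segUp (bw W B) ((L : ℤ) • y + ρ) μ L).sum
              + cross (segUp (pairForm W B) ((L : ℤ) • y + ρ) μ L))
            + ((segUp B ((L : ℤ) • y + ρ) μ L).sum * (segUp W ((L : ℤ) • y + ρ) μ L).sum
              + (segUp W ((L : ℤ) • y + ρ) μ L).sum * (segUp B ((L : ℤ) • y + ρ) μ L).sum))) := by
    rw [← mk_eq (holG (Yf W B) (Yb W B) (segUp δ ((L : ℤ) • y + ρ) μ L)), k0, k1, k1', eq_half h2 kx]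
  -- assemble (42)ρ
  rw [PhiGAt, Finset.sum_congr rfl hb, kc, sum_mk_zero, smul_mk, expT_of_c00 _ (by simp)]
  simp only [c10_mk, c01_mk, c11_mk, smul_zero]
  rw [logT_of_c00 _ (by simp)]
  simp only [c11_mk, c10_mk, c01_mk, c00_mk, c11_mul, c10_mul, c01_mul]
  simp only [mul_one, one_mul]
  -- contour bookkeeping and node 7aρ's definitions
  rw [← Finset.smul_sum, Finset.sum_add_distrib, eq_sub_of_add_eq (sum_box_sum_loopCAt_add ρ W L μ y),
    eq_sub_of_add_eq (sum_box_sum_loopCAt_add ρ B L μ y), eq_sub_of_add_eq (sum_box_sum_loopCAt_add ρ (bw W B) L μ y)]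
  simp only [hessUAt, AveragingHessianKernels.comm, ← Nat.cast_smul_eq_nsmul 𝕜, ← Int.cast_smul_eq_zsmul 𝕜, Nat.cast_pow,
    Int.cast_pow, Int.cast_natCast]
  -- the letter functionals are now opaque atoms of a `𝕜`-module identity
  generalize (∑ b ∈ box d L, cross (loopCAt ρ (pairForm W B) L μ y b)) = Xb
  generalize cross (segUp (pairForm W B) ((L : ℤ) • y + ρ) μ L) = Xc
  generalize linAvgAt ρ (bw W B) L μ y = Lbw
  generalize (segUp (bw W B) ((L : ℤ) • y + ρ) μ L).sum = cbw
  generalize linAvgAt ρ B L μ y = lB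
  generalize linAvgAt ρ W L μ y = lW
  generalize (segUp B ((L : ℤ) • y + ρ) μ L).sum = cB
  generalize (segUp W ((L : ℤ) • y + ρ) μ L).sum = cW
  generalize ((L : 𝕜) ^ d) = ℓ at hℓ ⊢
  simp only [smul_sub, smul_add, mul_add, add_mul, mul_sub, sub_mul, smul_mul_assoc, mul_smul_comm, smul_smul]
  match_scalars <;> (field_simp; try ring)

/-! ## §3 Top-slot perturbations and the symmetric letter `Zf W V = Y(V;W) + τ₁τ₂ · ½[W,V]` -/

omit [Algebra 𝕜 𝔸] in
/-- [folklore] Right multiplication by a top-slot element sees only `c00`. -/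
theorem mul_mk_top (p : Tau 𝔸) (s : 𝔸) : p * mk 0 0 0 s = mk 0 0 0 (c00 p * s) :=
  ext4 (by simp) (by simp) (by simp) (by simp)

omit [Algebra 𝕜 𝔸] in
/-- [folklore] Left multiplication by a top-slot element sees only `c00`. -/
theorem mk_top_mul (p : Tau 𝔸) (s : 𝔸) : mk 0 0 0 s * p = mk 0 0 0 (s * c00 p) :=
  ext4 (by simp) (by simp) (by simp) (by simp)

omit [Algebra 𝕜 𝔸] in
/-- [folklore] Top-slot elements add in the top slot. -/
theorem mk_top_add (s t : 𝔸) : (mk 0 0 0 s : Tau 𝔸) + mk 0 0 0 t = mk 0 0 0 (s + t) :=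
  ext4 (by simp) (by simp) (by simp) (by simp)

omit [Algebra 𝕜 𝔸] in
/-- [folklore] Group-like letters have group-like holonomies (`c00 = 1`; the `Tau.aug`-instance of leaf-05-g7's `aug_holG_eq_one`). -/
theorem c00_holG {G Gb : Form1 d (Tau 𝔸)} (hG : ∀ κ x, c00 (G κ x) = 1) (hGb : ∀ κ x, c00 (Gb κ x) = 1)
    {P : (Fin d → ℤ) → Prop} {l : List (LetterGrp d)} (hl : LettersIn δ P l) : c00 (holG G Gb l) = 1 := by
  induction l with
  | nil => rw [holG_nil, c00_one]
  | cons a l ih =>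
    obtain ⟨κ, x, -, rfl | rfl⟩ := hl a (by simp)
    · rw [holG_cons, realize_delta, c00_mul, hG, ih (fun b hb => hl b (by simp [hb])), one_mul]
    · rw [holG_cons, realize_neg_delta, c00_mul, hGb, ih (fun b hb => hl b (by simp [hb])), one_mul]

/-- [folklore] `c00 (logT q) = 0` for group-like `q`. -/
theorem c00_logT {q : Tau 𝔸} (h : c00 q = 1) : c00 (logT 𝕜 q) = 0 := by
  rw [logT_of_c00 _ h, c00_mk]

/-- [folklore] The averaged exponent `L^{-d} Σ_x logT hol(loop^ρ_x)` of group-like letters lies in the augmentation ideal. -/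
theorem c00_avg_logT_holG {G Gb : Form1 d (Tau 𝔸)} (hG : ∀ κ x, c00 (G κ x) = 1) (hGb : ∀ κ x, c00 (Gb κ x) = 1)
    (ρ : Fin d → ℤ) (L : ℕ) (μ : Fin d) (y : Fin d → ℤ) :
    c00 (((L : 𝕜) ^ d)⁻¹ • ∑ b ∈ box d L, logT 𝕜 (holG G Gb (loopCAt ρ δ L μ y b))) = 0 := by
  rw [c00_smul, ← Tau.aug_apply (𝕜 := 𝕜), map_sum, Finset.sum_eq_zero, smul_zero]
  intro b _
  rw [Tau.aug_apply, c00_logT (c00_holG hG hGb (lettersIn_loopCAt_top ρ δ L μ y b))]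

/-- [folklore] Group-like letters have a group-like rooted averaging (`c00 Φ^ρ = 1`; the `Tau.aug`-instance of leaf-05-g7's
`aug_PhiGAt_eq_one`). -/
theorem c00_PhiGAt {G Gb : Form1 d (Tau 𝔸)} (hG : ∀ κ x, c00 (G κ x) = 1) (hGb : ∀ κ x, c00 (Gb κ x) = 1) (ρ : Fin d → ℤ)
    (L : ℕ) (μ : Fin d) (y : Fin d → ℤ) : c00 (PhiGAt 𝕜 ρ G Gb L μ y) = 1 := by
  rw [PhiGAt, c00_mul, expT_of_c00 _ (c00_avg_logT_holG hG hGb ρ L μ y), c00_mk, one_mul,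
    c00_holG hG hGb (lettersIn_segUp_top δ _ μ L)]

/-- [folklore] `logT (q + τ₁τ₂ s) = logT q + τ₁τ₂ s` for group-like `q`. -/
theorem logT_add_top (q : Tau 𝔸) (h : c00 q = 1) (s : 𝔸) : logT 𝕜 (q + mk 0 0 0 s) = logT 𝕜 q + mk 0 0 0 s := by
  rw [logT_of_c00 _ (by simp [h]), logT_of_c00 _ h]
  exact ext4 (by simp) (by simp) (by simp) (by simp; abel)

/-- [folklore] `expT (A + τ₁τ₂ S) = expT A + τ₁τ₂ S` for `A` in the augmentation ideal. -/
theorem expT_add_top (A : Tau 𝔸) (h : c00 A = 0) (S : 𝔸) : expT 𝕜 (A + mk 0 0 0 S) = expT 𝕜 A + mk 0 0 0 S := by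
  rw [expT_of_c00 _ (by simp [h]), expT_of_c00 _ h]
  exact ext4 (by simp) (by simp) (by simp) (by simp; abel)

omit [Algebra 𝕜 𝔸] in
/-- [folklore] **TOP-SLOT PERTURBATIONS ARE ADDITIVE THROUGH HOLONOMY**: for group-like letters `(G, Ḡ)` and a scalar form `c`,
`hol(G + τ₁τ₂ c, Ḡ − τ₁τ₂ c) = hol(G, Ḡ) + τ₁τ₂ · Σ_ℓ c` along any list of oriented bond letters. -/
theorem holG_add_top {G Gb : Form1 d (Tau 𝔸)} (hG : ∀ κ x, c00 (G κ x) = 1) (hGb : ∀ κ x, c00 (Gb κ x) = 1) (c : Form1 d 𝔸)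
    {P : (Fin d → ℤ) → Prop} {l : List (LetterGrp d)} (hl : LettersIn δ P l) :
    holG (fun κ x => G κ x + mk 0 0 0 (c κ x)) (fun κ x => Gb κ x - mk 0 0 0 (c κ x)) l
      = holG G Gb l + mk 0 0 0 ((l.map (letterHom c)).sum) := by
  induction l with
  | nil => simp only [holG_nil, List.map_nil, List.sum_nil]; exact ext4 (by simp) (by simp) (by simp) (by simp)
  | cons a l ih =>
    have hl' : LettersIn δ P l := fun b hb => hl b (by simp [hb])
    have h0 : c00 (holG G Gb l) = 1 := c00_holG hG hGb hl'
    obtain ⟨κ, x, -, rfl | rfl⟩ := hl a (by simp)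
    · rw [holG_cons, holG_cons, realize_delta, realize_delta, ih hl', List.map_cons, List.sum_cons, letterHom_δ, add_mul,
        mul_add, mul_add, mul_mk_top, mk_top_mul, mk_top_mul, hG, h0, c00_mk, one_mul, mul_one, mul_zero]
      exact ext4 (by simp) (by simp) (by simp) (by simp; abel)
    · rw [holG_cons, holG_cons, realize_neg_delta, realize_neg_delta, ih hl', List.map_cons, List.sum_cons, map_neg,
        letterHom_δ, sub_mul, mul_add, mul_add, mul_mk_top, mk_top_mul, mk_top_mul, hGb, h0, c00_mk, one_mul, mul_one,
        mul_zero]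
      exact ext4 (by simp) (by simp) (by simp) (by simp; abel)

/-- [folklore] **… AND THROUGH THE ROOTED AVERAGING**: `Φ^ρ(G + τ₁τ₂ c, Ḡ − τ₁τ₂ c) = Φ^ρ(G, Ḡ) + τ₁τ₂ (c(c^ρ) + L^{-d} Σ_x c(loop^ρ_x))`. -/
theorem PhiGAt_add_top {G Gb : Form1 d (Tau 𝔸)} (hG : ∀ κ x, c00 (G κ x) = 1) (hGb : ∀ κ x, c00 (Gb κ x) = 1) (c : Form1 d 𝔸)
    (ρ : Fin d → ℤ) (L : ℕ) (μ : Fin d) (y : Fin d → ℤ) :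
    PhiGAt 𝕜 ρ (fun κ x => G κ x + mk 0 0 0 (c κ x)) (fun κ x => Gb κ x - mk 0 0 0 (c κ x)) L μ y
      = PhiGAt 𝕜 ρ G Gb L μ y
        + mk 0 0 0 ((segUp c ((L : ℤ) • y + ρ) μ L).sum + ((L : 𝕜) ^ d)⁻¹ • ∑ b ∈ box d L, (loopCAt ρ c L μ y b).sum) := by
  have hlog : ∀ b ∈ box d L,
      logT 𝕜 (holG (fun κ x => G κ x + mk 0 0 0 (c κ x)) (fun κ x => Gb κ x - mk 0 0 0 (c κ x)) (loopCAt ρ δ L μ y b))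
        = logT 𝕜 (holG G Gb (loopCAt ρ δ L μ y b)) + mk 0 0 0 ((loopCAt ρ c L μ y b).sum) := by
    intro b _
    rw [holG_add_top hG hGb c (lettersIn_loopCAt_top ρ δ L μ y b), loopCAt_map, mapForm_letterHom,
      logT_add_top _ (c00_holG hG hGb (lettersIn_loopCAt_top ρ δ L μ y b))]
  have hA := c00_avg_logT_holG (𝕜 := 𝕜) hG hGb ρ L μ y
  have hE : c00 (expT 𝕜 (((L : 𝕜) ^ d)⁻¹ • ∑ b ∈ box d L, logT 𝕜 (holG G Gb (loopCAt ρ δ L μ y b)))) = 1 := by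
    rw [expT_of_c00 _ hA, c00_mk]
  have hC := c00_holG hG hGb (lettersIn_segUp_top δ ((L : ℤ) • y + ρ) μ L)
  rw [PhiGAt, PhiGAt, Finset.sum_congr rfl hlog, Finset.sum_add_distrib, sum_mk_zero, smul_add, smul_mk]
  simp only [Finset.sum_const_zero, smul_zero]
  rw [expT_add_top _ hA, holG_add_top hG hGb c (lettersIn_segUp_top δ _ μ L), segUp_map, mapForm_letterHom, add_mul, mul_add,
    mul_add, mul_mk_top, mk_top_mul, mk_top_mul, hE, hC, c00_mk, one_mul, mul_one, mul_zero, mk_top_add, add_zero, add_assoc,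
    mk_top_add]

/-- [folklore] `½a + ½a = a` (`2` invertible in `𝕜`). -/
theorem half_add_half (h2 : (2 : 𝕜) ≠ 0) (a : 𝔸) : (2 : 𝕜)⁻¹ • a + (2 : 𝕜)⁻¹ • a = a := by
  rw [← add_smul, ← two_mul, mul_inv_cancel₀ h2, one_smul]

/-- [folklore] THE SYMMETRIC LETTER IS A TOP-SLOT PERTURBATION OF THE SHADOW LETTER: `Zf W V = Y(V;W) + τ₁τ₂ · ½[W,V]`. -/
theorem Zf_eq_Yf_add (h2 : (2 : 𝕜) ≠ 0) (W V : Form1 d 𝔸) :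
    Zf 𝕜 W V = fun κ x => Yf V W κ x + mk 0 0 0 ((2 : 𝕜)⁻¹ • bw W V κ x) := by
  funext κ x
  refine ext4 (by simp [Zf, Yf]) (by simp [Zf, Yf]) (by simp [Zf, Yf]) ?_
  simp only [Zf, Yf, c11_mk, c11_add, bw_apply, AveragingHessianKernels.comm]
  match_scalars <;> (field_simp; try ring)

/-- [folklore] … and `Zb W V = Ȳ(V;W) − τ₁τ₂ · ½[W,V]`. -/
theorem Zb_eq_Yb_sub (h2 : (2 : 𝕜) ≠ 0) (W V : Form1 d 𝔸) :
    Zb 𝕜 W V = fun κ x => Yb V W κ x - mk 0 0 0 ((2 : 𝕜)⁻¹ • bw W V κ x) := by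
  funext κ x
  refine ext4 (by simp [Zb, Yb]) (by simp [Zb, Yb]) (by simp [Zb, Yb]) ?_
  simp only [Zb, Yb, c11_mk, c11_sub, bw_apply, AveragingHessianKernels.comm]
  match_scalars <;> (field_simp; try ring)

omit [Algebra 𝕜 𝔸] in
/-- [folklore] `linAvgAt ρ [V,W] = − linAvgAt ρ [W,V]`. -/
theorem linAvgAt_bw_swap (ρ : Fin d → ℤ) (W V : Form1 d 𝔸) (L : ℕ) (μ : Fin d) (y : Fin d → ℤ) :
    linAvgAt ρ (bw V W) L μ y = -linAvgAt ρ (bw W V) L μ y := by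
  have h : bw V W = mapForm (-(AddMonoidHom.id 𝔸)) (bw W V) := by
    funext κ x; simp [mapForm, AveragingHessianKernels.comm, neg_sub]
  rw [h, linAvgAt_mapForm]; rfl

/-- [folklore] `linAvgAt ρ (c • A) = c • linAvgAt ρ A`. -/
theorem linAvgAt_smul (ρ : Fin d → ℤ) (c : 𝕜) (A : Form1 d 𝔸) (L : ℕ) (μ : Fin d) (y : Fin d → ℤ) :
    linAvgAt ρ (fun κ x => c • A κ x) L μ y = c • linAvgAt ρ A L μ y := by
  have h : (fun κ x => c • A κ x) = mapForm (DistribSMul.toAddMonoidHom 𝔸 c) A := by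
    funext κ x; simp [mapForm]
  rw [h, linAvgAt_mapForm]; rfl

/-- [folklore] **THE SYMMETRIC CHART COMPUTES THE POLARISED ROOTED HESSIAN FUNCTIONAL**:
`c11 (logT Φ^ρ(Zf W V, Zb W V)) = (2L^d)⁻¹ • hessUAt ρ W V` — the local commutator letter sums of §2 and of the perturbation cancel exactly. -/
theorem c11_logT_PhiGAt_Zf (ρ : Fin d → ℤ) (W V : Form1 d 𝔸) {L : ℕ} (hL : (L : 𝕜) ≠ 0) (h2 : (2 : 𝕜) ≠ 0) (μ : Fin d)
    (y : Fin d → ℤ) :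
    c11 (logT 𝕜 (PhiGAt 𝕜 ρ (Zf 𝕜 W V) (Zb 𝕜 W V) L μ y)) = ((2 : 𝕜) * (L : 𝕜) ^ d)⁻¹ • hessUAt ρ W V L μ y := by
  have hℓ : ((L : 𝕜) ^ d) ≠ 0 := pow_ne_zero d hL
  have hY : ∀ κ x, c00 (Yf V W κ x) = 1 := fun κ x => by simp [Yf]
  have hYb : ∀ κ x, c00 (Yb V W κ x) = 1 := fun κ x => by simp [Yb]
  have h1 : c00 (PhiGAt 𝕜 ρ (Yf V W) (Yb V W) L μ y) = 1 := c00_PhiGAt hY hYb ρ L μ y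
  rw [Zf_eq_Yf_add h2, Zb_eq_Yb_sub h2, PhiGAt_add_top hY hYb _ ρ L μ y, logT_add_top _ h1, c11_add, c11_mk,
    c11_logT_PhiGAt_Y ρ V W hL h2, inv_smul_sum_box_loopCAt ρ _ hL, add_sub_cancel, linAvgAt_smul, linAvgAt_bw_swap,
    hessUAt_symm, smul_smul, ← mul_inv, smul_add, smul_neg]
  rw [show (L : 𝕜) ^ d * 2 = 2 * (L : 𝕜) ^ d from mul_comm _ _]
  abel

end Summit.QuantumFields.BalabanUV.Beta.RootedJetDictionary
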